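import Mathlib.Analysis.SpecialFunctions.Arsinh
import Mathlib.Analysis.SpecialFunctions.Trigonometric.DerivHyp
import Mathlib.Analysis.SpecialFunctions.Log.Deriv
import Mathlib.Analysis.Calculus.MeanValue
import Literature.Probability.LatticeModels.HardCoreSpatialMixing
import Literature.Probability.LatticeModels.IndependencePolynomialProofs
import HarnessLib

/-!
# Proof of Weitz's strong spatial mixing theorem for the hard-core model

Topic `Literature/Probability/LatticeModels` — companion ("Proofs") file of
`HardCoreSpatialMixing.lean`, discharging its named fact `Weitz2006_hardCoreSSM`
[Weitz2006, Cor. 2.6]: for `Δ ≥ 3` and `0 < λ < λ_c(Δ) = (Δ-1)^{Δ-1}/(Δ-2)^Δ` there are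
`C, α > 0` such that the hard-core model at activity `λ` on every finite graph of maximum degree
`≤ Δ` has strong spatial mixing with rate `C e^{-αℓ}` (`Weitz2006_hardCoreSSM_holds`).

## The argument

All computations take place on the graph `G` itself, with boundary conditions `(Λ, R)`
(`R ⊆ Λ` occupied, `Λ \ R` unoccupied) and the restricted partition functions
`Z^{Λ,R} = hardCoreZ G λ Λ R` of the statement file.

* *Weitz's recursion* [Weitz2006, §3, proof of Thm. 3.1].  For a free vertex `v ∉ Λ` put
  `ρ_v = Z^{Λ∪{v},R∪{v}} / Z^{Λ∪{v},R}` (occupied-to-unoccupied ratio, so that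
  `p_v = ρ_v/(1+ρ_v)`, `hardCoreOccProb_eq_ratio`).  Removing the occupied vertex `v` gives
  `Z^{Λ∪{v},R∪{v}} = λ Z^{Λ∪{v}∪N(v),R}` (`hardCoreZ_insert_insert_eq_mul`; it is `0` if the
  boundary condition occupies a neighbour of `v`), and prescribing the free neighbours
  `u₁, …, u_k` of `v` unoccupied one at a time telescopes
  `Z^{Λ∪{v}∪N(v),R} / Z^{Λ∪{v},R} = ∏ᵢ 1/(1 + ρ_{uᵢ})`, the ratio `ρ_{uᵢ}` being computed with
  the boundary set `L_{uᵢ} = Λ ∪ {v, u₁, …, u_{i-1}}` (`hardCoreZ_telescope`,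
  `ratio_eq_mul_prod`).  This is the computation tree of the self-avoiding-walk tree
  `T_saw(G, v)`: every child is a free vertex *of the same graph* with an enlarged boundary set
  containing its parent, hence with at most `Δ - 1` free neighbours
  (`card_neighborFinset_sdiff_le`) — Weitz's "`T̂_b` is the worst case" (Thm. 2.3).
* *Contraction in the potential `y = arsinh √ρ`* (Li–Lu–Yin; Restrepo–Shin–Tetali–Vigoda–Yang
  [RestrepoEtAl2012, §4.1, Thm. 5 and Lemma 4]; this replaces Weitz's appeal to Kelly's weak
  spatial mixing on the regular tree, Thm. 2.4 and Prop. 2.5).  In this coordinate the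
  recursion reads `√ρ_v = √λ ∏ᵤ (cosh y_u)⁻¹` (`sqrt_mul_prod_inv_one_add`); along the segment
  between two vectors of children values the derivative of `arsinh (√λ ∏ᵤ (cosh zᵤ)⁻¹)` is
  bounded by `Q/√(1+Q²) · ∑ᵤ |tanh zᵤ| · max |y_u - y'_u|`, `Q = √λ ∏ (cosh zᵤ)⁻¹`
  (`arsinh_potential_lipschitz`, the mean value theorem), and
  `Q ∑ᵤ |tanh zᵤ| ≤ κ √(1+Q²)` with `κ² = λ(λ_c+1)/(λ_c(1+λ)) < 1` as soon as there are at most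
  `Δ - 1` children and `λ < λ_c(Δ)` (`potential_gradient_bound`) — this is exactly the inequality
  `PetersRegts.contraction_bound` (Cauchy–Schwarz, AM–GM and the tangent line at the symmetric
  critical point) already proved in `IndependencePolynomialProofs.lean` for the Peters–Regts
  theorem [PetersRegts2019, Prop. 3.6].
* *Induction on the agreement radius* (`arsinh_sqrt_ratio_sub_le`): if two feasible boundary
  conditions on `Λ` agree on the ball of radius `n` about the free vertex `v` (with `≤ Δ - 1`
  free neighbours), then `|y_v - y'_v| ≤ κⁿ arsinh √λ`; the root, which may have `Δ` free
  neighbours, is treated with the crude bound `|√ρ_v - √ρ'_v| ≤ √λ Δ max |y_u - y'_u|`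
  (`hardCoreOccProb_sub_le_of_agree`), and `|p - p'| ≤ |√ρ - √ρ'|`.
* *Constants* (`Weitz2006_hardCoreSSM_holds`): `α = -log κ`,
  `C = (1 + √λ Δ arsinh √λ)/κ²`; a prescribed vertex `v ∈ Λ` has `p_v = p'_v ∈ {0,1}` once the
  boundary conditions agree at `v`, and `ℓ ≤ 1` is covered by `|p - p'| ≤ 1 ≤ C κ^ℓ`.

Not here: the self-avoiding-walk tree as a graph and Theorem 3.1 as an identity of measures,
weak spatial mixing, Weitz's case `b = 1`, the algorithmic consequences (Thm. 2.7, Cor. 2.8).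

## References

* D. Weitz, *Counting independent sets up to the tree threshold*, Proc. 38th STOC (2006)
  140–149, doi:10.1145/1132516.1132538: §2 Def. 2.2, Thm. 2.3–2.4, Prop. 2.5, Cor. 2.6;
  §3 Thm. 3.1 (numbering of the author's full version). [Weitz2006]
* R. Restrepo, J. Shin, P. Tetali, E. Vigoda, L. Yang, *Improved mixing condition on the grid
  for counting and sampling independent sets*, Probab. Theory Related Fields **156** (2013)
  75–99, arXiv:1105.0914: §2.2 Thm. 1 (= Weitz's Thm. 3.1) and Cor. 2, §4 Lemma 4 and §4.1
  Thm. 5 (SSM below `λ_c(𝕋_Δ)` by a message potential). [RestrepoEtAl2012]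
* H. Peters, G. Regts, *On a conjecture of Sokal concerning roots of the independence
  polynomial*, Michigan Math. J. **68** (2019) 33–55, arXiv:1701.08049: Prop. 3.6.
  [PetersRegts2019]
-/

noncomputable section

open Finset

namespace Literature.Probability.LatticeModels

namespace Weitz

section Combinatorics

variable {V : Type*} [Fintype V] [DecidableEq V] (G : SimpleGraph V) [DecidableRel G.Adj]

/-- Prescribing more vertices unoccupied can only decrease the restricted partition function:
for `Λ ⊆ Λ'` and `R ⊆ Λ`, `Z^{Λ',R} ≤ Z^{Λ,R}` (`λ ≥ 0`). [folklore] -/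
theorem hardCoreZ_anti {lam : ℝ} (hlam : 0 ≤ lam) {Λ Λ' R : Finset V} (hΛ : Λ ⊆ Λ')
    (hR : R ⊆ Λ) : hardCoreZ G lam Λ' R ≤ hardCoreZ G lam Λ R := by
  unfold hardCoreZ
  refine sum_le_sum fun I _ => ?_
  by_cases h : G.IsIndepSet (I : Set V) ∧ I ∩ Λ' = R
  · have h' : G.IsIndepSet (I : Set V) ∧ I ∩ Λ = R := by
      refine ⟨h.1, ?_⟩
      calc I ∩ Λ = I ∩ (Λ' ∩ Λ) := by rw [inter_eq_right.2 hΛ]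
        _ = (I ∩ Λ') ∩ Λ := (inter_assoc _ _ _).symm
        _ = R ∩ Λ := by rw [h.2]
        _ = R := inter_eq_left.2 hR
    rw [if_pos h, if_pos h']
  · rw [if_neg h]
    split_ifs
    · positivity
    · exact le_rfl

omit [Fintype V] in
/-- The boundary condition "`v` occupied" in terms of `Λ`: for `v ∉ Λ`, `v ∉ R`,
`I ∩ (Λ ∪ {v}) = R ∪ {v}` iff `v ∈ I` and `I ∩ Λ = R`. [folklore] -/
theorem inter_insert_eq_insert_iff {Λ R I : Finset V} {v : V} (hvΛ : v ∉ Λ) (hvR : v ∉ R) :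
    I ∩ insert v Λ = insert v R ↔ v ∈ I ∧ I ∩ Λ = R := by
  constructor
  · intro h
    have hvI : v ∈ I := (mem_inter.1 (h.symm ▸ mem_insert_self v R)).1
    refine ⟨hvI, ?_⟩
    rw [inter_insert_of_mem hvI] at h
    rw [← erase_insert (notMem_mono inter_subset_right hvΛ : v ∉ I ∩ Λ), h, erase_insert hvR]
  · rintro ⟨hvI, h⟩
    rw [inter_insert_of_mem hvI, h]

omit [Fintype V] in
/-- The boundary condition "`v` unoccupied" in terms of `Λ`: for `v ∉ R`,
`I ∩ (Λ ∪ {v}) = R` iff `v ∉ I` and `I ∩ Λ = R`. [folklore] -/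
theorem inter_insert_eq_iff {Λ R I : Finset V} {v : V} (hvR : v ∉ R) :
    I ∩ insert v Λ = R ↔ v ∉ I ∧ I ∩ Λ = R := by
  constructor
  · intro h
    have hvI : v ∉ I := fun hvI => hvR (h ▸ mem_inter.2 ⟨hvI, mem_insert_self v Λ⟩)
    refine ⟨hvI, ?_⟩
    rwa [inter_insert_of_notMem hvI] at h
  · rintro ⟨hvI, h⟩
    rw [inter_insert_of_notMem hvI, h]

/-- **Splitting at a free vertex.** For `v ∉ Λ ⊇ R`:
`Z^{Λ,R} = Z^{Λ∪{v},R} + Z^{Λ∪{v},R∪{v}}` (`v` unoccupied / occupied). [folklore] -/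
theorem hardCoreZ_split {lam : ℝ} {Λ R : Finset V} {v : V} (hvΛ : v ∉ Λ) (hR : R ⊆ Λ) :
    hardCoreZ G lam Λ R =
      hardCoreZ G lam (insert v Λ) R + hardCoreZ G lam (insert v Λ) (insert v R) := by
  have hvR : v ∉ R := fun h => hvΛ (hR h)
  unfold hardCoreZ
  rw [← sum_add_distrib]
  refine sum_congr rfl fun I _ => ?_
  by_cases hI : G.IsIndepSet (I : Set V) ∧ I ∩ Λ = R
  · rw [if_pos hI]
    by_cases hvI : v ∈ I
    · rw [if_neg (fun h => ((inter_insert_eq_iff hvR).1 h.2).1 hvI),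
        if_pos ⟨hI.1, (inter_insert_eq_insert_iff hvΛ hvR).2 ⟨hvI, hI.2⟩⟩, zero_add]
    · rw [if_pos ⟨hI.1, (inter_insert_eq_iff hvR).2 ⟨hvI, hI.2⟩⟩,
        if_neg (fun h => hvI ((inter_insert_eq_insert_iff hvΛ hvR).1 h.2).1), add_zero]
  · rw [if_neg hI, if_neg (fun h => hI ⟨h.1, ((inter_insert_eq_iff hvR).1 h.2).2⟩),
      if_neg (fun h => hI ⟨h.1, ((inter_insert_eq_insert_iff hvΛ hvR).1 h.2).2⟩), add_zero]

/-- The numerator of the occupation probability at a free vertex is the "`v` occupied"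
partition function: for `v ∉ Λ ⊇ R`, `p_v^{Λ,R} = Z^{Λ∪{v},R∪{v}} / Z^{Λ,R}`. [folklore] -/
theorem hardCoreOccProb_eq_div {lam : ℝ} {Λ R : Finset V} {v : V} (hvΛ : v ∉ Λ) (hR : R ⊆ Λ) :
    hardCoreOccProb G lam Λ R v =
      hardCoreZ G lam (insert v Λ) (insert v R) / hardCoreZ G lam Λ R := by
  have hvR : v ∉ R := fun h => hvΛ (hR h)
  unfold hardCoreOccProb hardCoreZ
  congr 1
  refine sum_congr rfl fun I _ => ?_
  have hiff : (G.IsIndepSet (I : Set V) ∧ I ∩ Λ = R ∧ v ∈ I) ↔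
      (G.IsIndepSet (I : Set V) ∧ I ∩ insert v Λ = insert v R) := by
    rw [inter_insert_eq_insert_iff hvΛ hvR]
    tauto
  by_cases h : G.IsIndepSet (I : Set V) ∧ I ∩ Λ = R ∧ v ∈ I
  · rw [if_pos h, if_pos (hiff.1 h)]
  · rw [if_neg h, if_neg (fun h' => h (hiff.2 h'))]

/-- If the boundary condition occupies a neighbour of `v`, then `v` cannot be occupied:
`Z^{Λ∪{v},R∪{v}} = 0` (for `v ∉ Λ`). [folklore] -/
theorem hardCoreZ_insert_insert_eq_zero {lam : ℝ} {Λ R : Finset V} {v : V} (hvΛ : v ∉ Λ)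
    (hR : R ⊆ Λ) (h : ∃ u ∈ R, G.Adj v u) :
    hardCoreZ G lam (insert v Λ) (insert v R) = 0 := by
  obtain ⟨u, huR, hvu⟩ := h
  have hvR : v ∉ R := fun h => hvΛ (hR h)
  unfold hardCoreZ
  refine sum_eq_zero fun I _ => ?_
  rw [if_neg]
  rintro ⟨hind, hI⟩
  obtain ⟨hvI, hIR⟩ := (inter_insert_eq_insert_iff hvΛ hvR).1 hI
  have huI : u ∈ I := (mem_inter.1 (hIR.symm ▸ huR)).1
  exact hind (mem_coe.2 hvI) (mem_coe.2 huI) hvu.ne hvu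

/-- **Removing an occupied vertex.** For `v ∉ Λ ⊇ R` with no neighbour of `v` in `R`,
`Z^{Λ∪{v},R∪{v}} = λ · Z^{Λ∪{v}∪N(v),R}`: the compatible independent sets containing `v` are
`{v} ∪ J` with `J` compatible, avoiding `v` and its neighbours (Weitz's first step,
`Z_G(v occupied) = λ Z_{G - N[v]}`). [cite: Weitz2006, §3 (proof of Thm. 3.1)] -/
theorem hardCoreZ_insert_insert_eq_mul {lam : ℝ} {Λ R : Finset V} {v : V} (hvΛ : v ∉ Λ)
    (hR : R ⊆ Λ) (h : ¬ ∃ u ∈ R, G.Adj v u) :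
    hardCoreZ G lam (insert v Λ) (insert v R) =
      lam * hardCoreZ G lam (insert v Λ ∪ G.neighborFinset v) R := by
  have hvR : v ∉ R := fun h => hvΛ (hR h)
  unfold hardCoreZ
  rw [mul_sum]
  -- both sums live on `{I | v ∈ I}` resp. `{J | v ∉ J}`
  rw [← sum_filter_add_sum_filter_not univ (fun I : Finset V => v ∈ I)]
  rw [← sum_filter_add_sum_filter_not univ (fun J : Finset V => v ∉ J)
    (fun J => lam * if G.IsIndepSet (J : Set V) ∧ J ∩ (insert v Λ ∪ G.neighborFinset v) = R
      then lam ^ J.card else 0)]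
  have hzero1 : ∑ I ∈ univ.filter (fun I : Finset V => ¬ v ∈ I),
      (if G.IsIndepSet (I : Set V) ∧ I ∩ insert v Λ = insert v R then lam ^ I.card else 0) = 0 := by
    refine sum_eq_zero fun I hI => ?_
    rw [if_neg]
    rintro ⟨-, h2⟩
    exact (mem_filter.1 hI).2 ((inter_insert_eq_insert_iff hvΛ hvR).1 h2).1
  have hzero2 : ∑ J ∈ univ.filter (fun J : Finset V => ¬ v ∉ J),
      lam * (if G.IsIndepSet (J : Set V) ∧ J ∩ (insert v Λ ∪ G.neighborFinset v) = R
        then lam ^ J.card else 0) = 0 := by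
    refine sum_eq_zero fun J hJ => ?_
    rw [if_neg, mul_zero]
    rintro ⟨-, h2⟩
    have hvJ : v ∈ J := not_not.1 (mem_filter.1 hJ).2
    exact hvR (h2 ▸ mem_inter.2 ⟨hvJ, mem_union_left _ (mem_insert_self v Λ)⟩)
  rw [hzero1, hzero2, add_zero, add_zero]
  symm
  refine sum_nbij' (fun J => insert v J) (fun I => I.erase v) ?_ ?_ ?_ ?_ ?_
  · intro J hJ
    exact mem_filter.2 ⟨mem_univ _, mem_insert_self v J⟩
  · intro I hI
    exact mem_filter.2 ⟨mem_univ _, notMem_erase v I⟩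
  · intro J hJ
    exact erase_insert (mem_filter.1 hJ).2
  · intro I hI
    exact insert_erase (mem_filter.1 hI).2
  · intro J hJ
    have hvJ : v ∉ J := (mem_filter.1 hJ).2
    have key : (G.IsIndepSet (J : Set V) ∧ J ∩ (insert v Λ ∪ G.neighborFinset v) = R) ↔
        (G.IsIndepSet ((insert v J : Finset V) : Set V) ∧
          (insert v J) ∩ insert v Λ = insert v R) := by
      rw [inter_insert_eq_insert_iff hvΛ hvR, coe_insert, SimpleGraph.isIndepSet_iff,
        SimpleGraph.isIndepSet_iff, Set.pairwise_insert]
      constructor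
      · rintro ⟨hind, hJ⟩
        refine ⟨⟨hind, fun u hu _ => ?_⟩, mem_insert_self v J, ?_⟩
        · have hvu : ¬ G.Adj v u := fun hvu => h ⟨u, hJ ▸ mem_inter.2 ⟨mem_coe.1 hu,
            mem_union_right _ ((G.mem_neighborFinset v u).2 hvu)⟩, hvu⟩
          exact ⟨hvu, fun h' => hvu h'.symm⟩
        · ext w
          rw [mem_inter, mem_insert]
          constructor
          · rintro ⟨hw | hw, hwΛ⟩
            · exact absurd hwΛ (hw ▸ hvΛ)
            · exact hJ ▸ mem_inter.2 ⟨hw, mem_union_left _ (mem_insert_of_mem hwΛ)⟩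
          · intro hwR
            exact ⟨Or.inr (mem_inter.1 (hJ.symm ▸ hwR)).1, hR hwR⟩
      · rintro ⟨⟨hind, hadj⟩, -, hJ⟩
        refine ⟨hind, ?_⟩
        ext w
        rw [mem_inter, mem_union, mem_insert, SimpleGraph.mem_neighborFinset]
        constructor
        · rintro ⟨hwJ, (hw | hwΛ) | hvw⟩
          · exact absurd hwJ (hw ▸ hvJ)
          · exact hJ ▸ mem_inter.2 ⟨mem_insert_of_mem hwJ, hwΛ⟩
          · exact absurd hvw (hadj w (mem_coe.2 hwJ) (fun h' => hvJ (h' ▸ hwJ))).1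
        · intro hwR
          exact ⟨mem_of_mem_insert_of_ne (mem_inter.1 (hJ.symm ▸ hwR)).1
            (ne_of_mem_of_not_mem hwR hvR), Or.inl (Or.inr (hR hwR))⟩
    by_cases hc : G.IsIndepSet (J : Set V) ∧ J ∩ (insert v Λ ∪ G.neighborFinset v) = R
    · rw [if_pos hc, if_pos (key.1 hc), card_insert_of_notMem hvJ, pow_succ, mul_comm]
    · rw [if_neg hc, if_neg (fun h' => hc (key.2 h')), mul_zero]


/-- `Z^{insert u L, R} / Z^{L, R} = 1 / (1 + ρ_u)` with the occupation ratio
`ρ_u = Z^{L∪{u},R∪{u}} / Z^{L∪{u},R}` of the free vertex `u ∉ L ⊇ R`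
(`P(u unoccupied) = 1 - p_u`). [folklore] -/
theorem hardCoreZ_insert_div {lam : ℝ} (hlam : 0 < lam) {L R : Finset V} {u : V} (hu : u ∉ L)
    (hR : R ⊆ L) (hind : G.IsIndepSet (R : Set V)) :
    hardCoreZ G lam (insert u L) R / hardCoreZ G lam L R =
      (1 + hardCoreZ G lam (insert u L) (insert u R) / hardCoreZ G lam (insert u L) R)⁻¹ := by
  have ha : 0 < hardCoreZ G lam (insert u L) R :=
    hardCoreZ_pos G hlam (hR.trans (subset_insert u L)) hind
  rw [hardCoreZ_split G hu hR, one_add_div ha.ne', inv_div]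

/-- **Telescoping over the free neighbours** (the product structure behind Weitz's
self-avoiding-walk tree, [Weitz2006, Thm. 3.1]): prescribing the vertices of `s` unoccupied one
at a time, `Z^{B∪s,R} = Z^{B,R} · ∏_{u ∈ s} Z^{L_u∪{u},R} / Z^{L_u,R}` for a family of
intermediate boundary sets `B ⊆ L_u ⊆ B ∪ s` with `u ∉ L_u`, the same family for every boundary
condition `R ⊆ B`. [cite: Weitz2006, Thm. 3.1 (proof)] -/
theorem hardCoreZ_telescope {lam : ℝ} (hlam : 0 < lam) (B : Finset V) :
    ∀ s : Finset V, Disjoint s B →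
      ∃ L : V → Finset V, (∀ u ∈ s, B ⊆ L u ∧ u ∉ L u ∧ L u ⊆ B ∪ s) ∧
        ∀ R : Finset V, R ⊆ B → G.IsIndepSet (R : Set V) →
          hardCoreZ G lam (B ∪ s) R = hardCoreZ G lam B R *
            ∏ u ∈ s, hardCoreZ G lam (insert u (L u)) R / hardCoreZ G lam (L u) R := by
  intro s
  induction s using Finset.induction_on with
  | empty =>
    intro _
    exact ⟨fun _ => B, fun u hu => absurd hu (notMem_empty u), fun R _ _ => by simp⟩
  | @insert w s hw ih =>
    intro hdisj
    have hdisj' : Disjoint s B := disjoint_of_subset_left (subset_insert w s) hdisj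
    have hwB : w ∉ B := disjoint_left.1 hdisj (mem_insert_self w s)
    obtain ⟨L, hL, hZ⟩ := ih hdisj'
    have hsub : B ∪ s ⊆ B ∪ insert w s := union_subset_union (Subset.refl B) (subset_insert w s)
    refine ⟨Function.update L w (B ∪ s), ?_, ?_⟩
    · intro u hu
      rcases mem_insert.1 hu with rfl | hus
      · rw [Function.update_self]
        exact ⟨subset_union_left, fun h => (mem_union.1 h).elim hwB hw, hsub⟩
      · rw [Function.update_of_ne (ne_of_mem_of_not_mem hus hw)]
        obtain ⟨h1, h2, h3⟩ := hL u hus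
        exact ⟨h1, h2, h3.trans hsub⟩
    · intro R hRB hind
      have hne : hardCoreZ G lam (B ∪ s) R ≠ 0 :=
        (hardCoreZ_pos G hlam (hRB.trans subset_union_left) hind).ne'
      rw [prod_insert hw, Function.update_self,
        prod_congr rfl fun u hu => by rw [Function.update_of_ne (ne_of_mem_of_not_mem hu hw)],
        union_insert]
      calc hardCoreZ G lam (insert w (B ∪ s)) R
          = hardCoreZ G lam (insert w (B ∪ s)) R / hardCoreZ G lam (B ∪ s) R *
              hardCoreZ G lam (B ∪ s) R := (div_mul_cancel₀ _ hne).symm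
        _ = hardCoreZ G lam (insert w (B ∪ s)) R / hardCoreZ G lam (B ∪ s) R *
              (hardCoreZ G lam B R * ∏ u ∈ s,
                hardCoreZ G lam (insert u (L u)) R / hardCoreZ G lam (L u) R) := by
            rw [← hZ R hRB hind]
        _ = _ := by ring

/-- **Weitz's recursion with boundary conditions** (the computation behind
[Weitz2006, Thm. 3.1], run on the graph itself): for a free vertex `v ∉ Λ ⊇ R` none of whose
neighbours is occupied by the boundary condition, the occupation ratio
`ρ_v = Z^{Λ∪{v},R∪{v}} / Z^{Λ∪{v},R}` equals `λ ∏_{u} 1 / (1 + ρ_u)` over the free neighbours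
`u` of `v`, where `ρ_u` is computed with the boundary set `L_u ⊇ Λ ∪ {v}` of
`hardCoreZ_telescope` (the neighbours before `u` prescribed unoccupied, `v` unoccupied).
[cite: Weitz2006, Thm. 3.1] -/
theorem ratio_eq_mul_prod {lam : ℝ} (hlam : 0 < lam) {Λ R : Finset V} {v : V} (hvΛ : v ∉ Λ)
    (hR : R ⊆ Λ) (hind : G.IsIndepSet (R : Set V)) (hno : ¬ ∃ u ∈ R, G.Adj v u)
    (L : V → Finset V)
    (hL : ∀ u ∈ G.neighborFinset v \ insert v Λ, insert v Λ ⊆ L u ∧ u ∉ L u)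
    (hZ : hardCoreZ G lam (insert v Λ ∪ (G.neighborFinset v \ insert v Λ)) R =
      hardCoreZ G lam (insert v Λ) R * ∏ u ∈ G.neighborFinset v \ insert v Λ,
        hardCoreZ G lam (insert u (L u)) R / hardCoreZ G lam (L u) R) :
    hardCoreZ G lam (insert v Λ) (insert v R) / hardCoreZ G lam (insert v Λ) R =
      lam * ∏ u ∈ G.neighborFinset v \ insert v Λ,
        (1 + hardCoreZ G lam (insert u (L u)) (insert u R) /
          hardCoreZ G lam (insert u (L u)) R)⁻¹ := by
  have hB : 0 < hardCoreZ G lam (insert v Λ) R :=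
    hardCoreZ_pos G hlam (hR.trans (subset_insert v Λ)) hind
  rw [hardCoreZ_insert_insert_eq_mul G hvΛ hR hno,
    show insert v Λ ∪ G.neighborFinset v = insert v Λ ∪ (G.neighborFinset v \ insert v Λ) from
      union_sdiff_self_eq_union.symm, hZ, mul_div_assoc, mul_div_cancel_left₀ _ hB.ne']
  congr 1
  refine prod_congr rfl fun u hu => ?_
  obtain ⟨h1, h2⟩ := hL u hu
  exact hardCoreZ_insert_div G hlam h2 ((hR.trans (subset_insert v Λ)).trans h1) hind

/-- The occupation probability of a free vertex in terms of its occupation ratio: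
`p_v = ρ_v / (1 + ρ_v)` for `v ∉ Λ ⊇ R`. [folklore] -/
theorem hardCoreOccProb_eq_ratio {lam : ℝ} (hlam : 0 < lam) {Λ R : Finset V} {v : V}
    (hvΛ : v ∉ Λ) (hR : R ⊆ Λ) (hind : G.IsIndepSet (R : Set V)) :
    hardCoreOccProb G lam Λ R v =
      (hardCoreZ G lam (insert v Λ) (insert v R) / hardCoreZ G lam (insert v Λ) R) /
        (1 + hardCoreZ G lam (insert v Λ) (insert v R) / hardCoreZ G lam (insert v Λ) R) := by
  have ha : 0 < hardCoreZ G lam (insert v Λ) R :=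
    hardCoreZ_pos G hlam (hR.trans (subset_insert v Λ)) hind
  rw [hardCoreOccProb_eq_div G hvΛ hR, hardCoreZ_split G hvΛ hR, one_add_div ha.ne',
    div_div_div_cancel_right₀ ha.ne']

/-- The occupation ratio is nonnegative (`λ ≥ 0`). [folklore] -/
theorem ratio_nonneg {lam : ℝ} (hlam : 0 ≤ lam) (Λ R : Finset V) (v : V) :
    0 ≤ hardCoreZ G lam (insert v Λ) (insert v R) / hardCoreZ G lam (insert v Λ) R :=
  div_nonneg (hardCoreZ_nonneg G hlam _ _) (hardCoreZ_nonneg G hlam _ _)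

/-- The occupation ratio of a free vertex is at most the activity: `ρ_v ≤ λ`
(`Z^{Λ∪{v}∪N(v),R} ≤ Z^{Λ∪{v},R}`). [folklore] -/
theorem ratio_le {lam : ℝ} (hlam : 0 < lam) {Λ R : Finset V} {v : V} (hvΛ : v ∉ Λ)
    (hR : R ⊆ Λ) (hind : G.IsIndepSet (R : Set V)) :
    hardCoreZ G lam (insert v Λ) (insert v R) / hardCoreZ G lam (insert v Λ) R ≤ lam := by
  have hB : 0 < hardCoreZ G lam (insert v Λ) R :=
    hardCoreZ_pos G hlam (hR.trans (subset_insert v Λ)) hind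
  rw [div_le_iff₀ hB]
  by_cases h : ∃ u ∈ R, G.Adj v u
  · rw [hardCoreZ_insert_insert_eq_zero G hvΛ hR h]
    positivity
  · rw [hardCoreZ_insert_insert_eq_mul G hvΛ hR h]
    exact mul_le_mul_of_nonneg_left
      (hardCoreZ_anti G hlam.le subset_union_left (hR.trans (subset_insert v Λ))) hlam.le

/-- Degree bookkeeping: in a graph of maximum degree `≤ d + 1`, a vertex `u` with a neighbour
`w` inside the boundary set `L` has at most `d` free neighbours. [folklore] -/
theorem card_neighborFinset_sdiff_le {d : ℕ} (hG : G.maxDegree ≤ d + 1) {u w : V}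
    {L : Finset V} (hw : w ∈ L) (hadj : G.Adj u w) : (G.neighborFinset u \ L).card ≤ d := by
  have hsub : G.neighborFinset u \ L ⊆ (G.neighborFinset u).erase w := fun x hx =>
    mem_erase.2 ⟨fun h => (mem_sdiff.1 hx).2 (h ▸ hw), (mem_sdiff.1 hx).1⟩
  calc (G.neighborFinset u \ L).card ≤ ((G.neighborFinset u).erase w).card := card_le_card hsub
    _ = G.degree u - 1 := by
        rw [card_erase_of_mem ((G.mem_neighborFinset u w).2 hadj),
          G.card_neighborFinset_eq_degree]
    _ ≤ d := by have := (G.degree_le_maxDegree u).trans hG; omega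

end Combinatorics


section Analysis

variable {ι : Type*}

/-- `|sinh z| ≤ cosh z`. [folklore] -/
theorem abs_sinh_le_cosh (z : ℝ) : |Real.sinh z| ≤ Real.cosh z := by
  rw [Real.abs_sinh, ← Real.cosh_abs]
  exact (Real.sinh_lt_cosh _).le

/-- `e^{-∑ log cosh zᵤ} = ∏ (cosh zᵤ)⁻¹`. [folklore] -/
theorem exp_neg_sum_log_cosh (s : Finset ι) (z : ι → ℝ) :
    Real.exp (-∑ u ∈ s, Real.log (Real.cosh (z u))) = ∏ u ∈ s, (Real.cosh (z u))⁻¹ := by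
  rw [Real.exp_neg, Real.exp_sum, ← prod_inv_distrib]
  refine prod_congr rfl fun u _ => ?_
  rw [Real.exp_log (Real.cosh_pos _)]

/-- The derivative of `x ↦ ∑ᵤ log cosh (aᵤ + x bᵤ)` is `∑ᵤ tanh (aᵤ + x bᵤ) bᵤ`. [folklore] -/
theorem hasDerivAt_sum_log_cosh (s : Finset ι) (a b : ι → ℝ) (x : ℝ) :
    HasDerivAt (fun x => ∑ u ∈ s, Real.log (Real.cosh (a u + x * b u)))
      (∑ u ∈ s, Real.sinh (a u + x * b u) * b u / Real.cosh (a u + x * b u)) x := by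
  refine HasDerivAt.fun_sum fun u _ => ?_
  have h1 : HasDerivAt (fun x => a u + x * b u) (b u) x := by
    simpa using ((hasDerivAt_id x).mul_const (b u)).const_add (a u)
  exact h1.cosh.log (Real.cosh_pos _).ne'

/-- In the potential coordinate `y = arsinh √ρ` the hard-core recursion `ρ = t ∏ᵤ (1 + ρᵤ)⁻¹`
reads `√ρ = √t ∏ᵤ (cosh yᵤ)⁻¹`. [folklore] -/
theorem sqrt_mul_prod_inv_one_add {t : ℝ} (ht : 0 ≤ t) (s : Finset ι) (r : ι → ℝ)
    (hr : ∀ u ∈ s, 0 ≤ r u) :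
    √(t * ∏ u ∈ s, (1 + r u)⁻¹) = √t * ∏ u ∈ s, (Real.cosh (Real.arsinh √(r u)))⁻¹ := by
  rw [Real.sqrt_mul ht, Real.sqrt_prod _ (fun u hu => by have := hr u hu; positivity)]
  congr 1
  refine prod_congr rfl fun u hu => ?_
  rw [Real.cosh_arsinh, Real.sq_sqrt (hr u hu), Real.sqrt_inv]

/-- **Mean value estimate along the segment in potential coordinates** (the step
`|F(m) - F(m')| ≤ ‖∇F‖₁ · max |mᵢ - m'ᵢ|` of the message-contraction arguments, cf.
Restrepo–Shin–Tetali–Vigoda–Yang, proof of Lemma 4): along `z(x) = y' + x (y - y')` the function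
`x ↦ arsinh (√t ∏ᵤ (cosh zᵤ(x))⁻¹)` has derivative of absolute value at most
`Q/√(1+Q²) · ∑ᵤ |tanh zᵤ| · ε`, `Q = √t ∏ᵤ (cosh zᵤ)⁻¹`, so a uniform bound
`Q ∑ᵤ |tanh zᵤ| ≤ K √(1+Q²)` makes it `K ε`-Lipschitz; and `x ↦ Q(x)` itself is
`√t · #s · ε`-Lipschitz. [cite: RestrepoEtAl2012, Lemma 4 (proof)] -/
theorem arsinh_potential_lipschitz (s : Finset ι) {t K ε : ℝ} (hε : 0 ≤ ε) (y y' : ι → ℝ)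
    (hclose : ∀ u ∈ s, |y u - y' u| ≤ ε)
    (hKb : ∀ z : ι → ℝ,
      √t * (∏ u ∈ s, (Real.cosh (z u))⁻¹) * ∑ u ∈ s, |Real.sinh (z u)| / Real.cosh (z u) ≤
        K * √(1 + (√t * ∏ u ∈ s, (Real.cosh (z u))⁻¹) ^ 2)) :
    |Real.arsinh (√t * ∏ u ∈ s, (Real.cosh (y u))⁻¹) -
        Real.arsinh (√t * ∏ u ∈ s, (Real.cosh (y' u))⁻¹)| ≤ K * ε ∧
      |√t * ∏ u ∈ s, (Real.cosh (y u))⁻¹ - √t * ∏ u ∈ s, (Real.cosh (y' u))⁻¹| ≤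
        √t * s.card * ε := by
  -- the functions along the segment `z(x) = y' + x (y - y')`
  obtain ⟨S, hS⟩ : ∃ S : ℝ → ℝ,
      S = fun x => ∑ u ∈ s, Real.log (Real.cosh (y' u + x * (y u - y' u))) := ⟨_, rfl⟩
  obtain ⟨S', hS'⟩ : ∃ S' : ℝ → ℝ, S' = fun x => ∑ u ∈ s,
      Real.sinh (y' u + x * (y u - y' u)) * (y u - y' u) / Real.cosh (y' u + x * (y u - y' u)) :=
    ⟨_, rfl⟩
  obtain ⟨Q, hQ⟩ : ∃ Q : ℝ → ℝ, Q = fun x => √t * Real.exp (-S x) := ⟨_, rfl⟩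
  have hSd : ∀ x, HasDerivAt S (S' x) x := fun x => by
    rw [hS, hS']
    exact hasDerivAt_sum_log_cosh s y' (fun u => y u - y' u) x
  have hQd : ∀ x, HasDerivAt Q (√t * (Real.exp (-S x) * -S' x)) x := fun x => by
    rw [hQ]
    exact ((hSd x).neg.exp).const_mul _
  have hFd : ∀ x, HasDerivAt (fun x => Real.arsinh (Q x))
      ((√(1 + Q x ^ 2))⁻¹ • (√t * (Real.exp (-S x) * -S' x))) x := fun x => (hQd x).arsinh
  have hQeq : ∀ x, Q x = √t * ∏ u ∈ s, (Real.cosh (y' u + x * (y u - y' u)))⁻¹ := fun x => by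
    rw [hQ, hS]
    exact congrArg (√t * ·) (exp_neg_sum_log_cosh s _)
  have hQ0 : ∀ x, 0 ≤ Q x := fun x => by rw [hQeq]; positivity
  have hS0 : ∀ x, 0 ≤ S x := fun x => by
    rw [hS]
    exact sum_nonneg fun u _ => Real.log_nonneg (Real.one_le_cosh _)
  have hQle : ∀ x, Q x ≤ √t := fun x => by
    rw [hQ]
    exact mul_le_of_le_one_right (Real.sqrt_nonneg _)
      (Real.exp_le_one_iff.2 (neg_nonpos.2 (hS0 x)))
  -- `|S' x| ≤ ε ∑ |tanh|`
  have hS'b : ∀ x, |S' x| ≤ ε * ∑ u ∈ s, |Real.sinh (y' u + x * (y u - y' u))| /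
      Real.cosh (y' u + x * (y u - y' u)) := by
    intro x
    rw [hS', mul_sum]
    refine (abs_sum_le_sum_abs _ _).trans (sum_le_sum fun u hu => ?_)
    rw [abs_div, abs_mul, abs_of_pos (Real.cosh_pos _), mul_div_right_comm, mul_comm ε]
    exact mul_le_mul_of_nonneg_left (hclose u hu) (by positivity)
  have hsum1 : ∀ x, ∑ u ∈ s, |Real.sinh (y' u + x * (y u - y' u))| /
      Real.cosh (y' u + x * (y u - y' u)) ≤ s.card := by
    intro x
    calc _ ≤ ∑ u ∈ s, (1 : ℝ) := sum_le_sum fun u _ =>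
          (div_le_one (Real.cosh_pos _)).2 (abs_sinh_le_cosh _)
      _ = s.card := by simp
  have hderiv : ∀ x, √t * (Real.exp (-S x) * -S' x) = -(Q x * S' x) := fun x => by
    rw [hQ]; ring
  -- bound for the derivative of `arsinh ∘ Q`
  have hFb : ∀ x, ‖(√(1 + Q x ^ 2))⁻¹ • (√t * (Real.exp (-S x) * -S' x))‖ ≤ K * ε := by
    intro x
    have hsq : 0 < √(1 + Q x ^ 2) := Real.sqrt_pos.2 (by positivity)
    rw [hderiv, smul_eq_mul, Real.norm_eq_abs, abs_mul, abs_inv, abs_of_pos hsq, abs_neg,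
      abs_mul, abs_of_nonneg (hQ0 x), inv_mul_le_iff₀ hsq]
    calc Q x * |S' x| ≤ Q x * (ε * ∑ u ∈ s, |Real.sinh (y' u + x * (y u - y' u))| /
          Real.cosh (y' u + x * (y u - y' u))) := mul_le_mul_of_nonneg_left (hS'b x) (hQ0 x)
      _ = (Q x * ∑ u ∈ s, |Real.sinh (y' u + x * (y u - y' u))| /
          Real.cosh (y' u + x * (y u - y' u))) * ε := by ring
      _ ≤ (K * √(1 + Q x ^ 2)) * ε := by
          refine mul_le_mul_of_nonneg_right ?_ hε
          rw [hQeq]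
          exact hKb _
      _ = √(1 + Q x ^ 2) * (K * ε) := by ring
  -- bound for the derivative of `Q`
  have hQb : ∀ x, ‖√t * (Real.exp (-S x) * -S' x)‖ ≤ √t * s.card * ε := by
    intro x
    rw [hderiv, norm_neg, Real.norm_eq_abs, abs_mul, abs_of_nonneg (hQ0 x)]
    calc Q x * |S' x| ≤ √t * (ε * s.card) := by
          refine mul_le_mul (hQle x) ((hS'b x).trans ?_) (abs_nonneg _) (Real.sqrt_nonneg _)
          exact mul_le_mul_of_nonneg_left (hsum1 x) hε
      _ = √t * s.card * ε := by ring
  -- the mean value theorem, twice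
  have hF := convex_univ.norm_image_sub_le_of_norm_hasDerivWithin_le
    (f := fun x => Real.arsinh (Q x)) (fun x _ => (hFd x).hasDerivWithinAt) (fun x _ => hFb x)
    (Set.mem_univ 0) (Set.mem_univ 1)
  have hQm := convex_univ.norm_image_sub_le_of_norm_hasDerivWithin_le (f := Q)
    (fun x _ => (hQd x).hasDerivWithinAt) (fun x _ => hQb x) (Set.mem_univ 0) (Set.mem_univ 1)
  have h1 : Q 1 = √t * ∏ u ∈ s, (Real.cosh (y u))⁻¹ := by
    rw [hQeq]
    congr 1
    refine prod_congr rfl fun u _ => ?_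
    ring_nf
  have h0 : Q 0 = √t * ∏ u ∈ s, (Real.cosh (y' u))⁻¹ := by
    rw [hQeq]
    congr 1
    refine prod_congr rfl fun u _ => ?_
    ring_nf
  simp only [sub_zero, norm_one, mul_one, Real.norm_eq_abs, h1, h0] at hF hQm
  exact ⟨hF, hQm⟩

/-- The trivial gradient bound (used at the root, which may have `Δ` free neighbours):
`Q ∑ᵤ |tanh zᵤ| ≤ #s √(1 + Q²)`. [folklore] -/
theorem potential_gradient_bound_card (t : ℝ) (s : Finset ι) (z : ι → ℝ) :
    √t * (∏ u ∈ s, (Real.cosh (z u))⁻¹) * ∑ u ∈ s, |Real.sinh (z u)| / Real.cosh (z u) ≤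
      s.card * √(1 + (√t * ∏ u ∈ s, (Real.cosh (z u))⁻¹) ^ 2) := by
  have hQ0 : 0 ≤ √t * ∏ u ∈ s, (Real.cosh (z u))⁻¹ := by positivity
  have hQle : √t * ∏ u ∈ s, (Real.cosh (z u))⁻¹ ≤
      √(1 + (√t * ∏ u ∈ s, (Real.cosh (z u))⁻¹) ^ 2) :=
    Real.le_sqrt_of_sq_le (by linarith)
  have hsum : ∑ u ∈ s, |Real.sinh (z u)| / Real.cosh (z u) ≤ s.card := by
    calc _ ≤ ∑ u ∈ s, (1 : ℝ) := sum_le_sum fun u _ =>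
          (div_le_one (Real.cosh_pos _)).2 (abs_sinh_le_cosh _)
      _ = s.card := by simp
  calc _ ≤ √(1 + (√t * ∏ u ∈ s, (Real.cosh (z u))⁻¹) ^ 2) * s.card :=
        mul_le_mul hQle hsum (sum_nonneg fun u _ => by positivity) (Real.sqrt_nonneg _)
    _ = _ := mul_comm _ _

/-- **The gradient bound up to the tree threshold** (Li–Lu–Yin / Restrepo–Shin–Tetali–Vigoda–Yang
potential `arsinh √·`; the inequality itself is `PetersRegts.contraction_bound` of
`IndependencePolynomialProofs.lean`, i.e. [PetersRegts2019, Prop. 3.6] with Cauchy–Schwarz and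
AM–GM): for `#s ≤ d` and `0 < t < λ_c(d+1)`,
`Q ∑ᵤ |tanh zᵤ| ≤ κ √(1 + Q²)` with `Q = √t ∏ᵤ (cosh zᵤ)⁻¹` and
`κ² = t (λ_c + 1) / (λ_c (1 + t)) < 1`. [cite: PetersRegts2019, Prop. 3.6] -/
theorem potential_gradient_bound {d : ℕ} {Λc t : ℝ} (hΛ : Λc = hardCoreThreshold (d + 1))
    (hΛpos : 0 < Λc) (ht0 : 0 < t) (htΛ : t < Λc) {s : Finset ι} (hsd : s.card ≤ d)
    (z : ι → ℝ) :
    √t * (∏ u ∈ s, (Real.cosh (z u))⁻¹) * ∑ u ∈ s, |Real.sinh (z u)| / Real.cosh (z u) ≤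
      √(t * (Λc + 1) / (Λc * (1 + t))) * √(1 + (√t * ∏ u ∈ s, (Real.cosh (z u))⁻¹) ^ 2) := by
  obtain ⟨σ, hσ⟩ : ∃ σ : ι → ℝ, σ = fun u => Real.log (Real.cosh (z u) ^ 2) := ⟨_, rfl⟩
  have hσ0 : ∀ u ∈ s, 0 ≤ σ u := fun u _ => by
    rw [hσ]
    exact Real.log_nonneg (one_le_pow₀ (Real.one_le_cosh _))
  have hC := PetersRegts.contraction_bound hΛ hΛpos ht0 htΛ hsd σ hσ0
  have h1 : ∀ u, √(1 - Real.exp (-σ u)) = |Real.sinh (z u)| / Real.cosh (z u) := by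
    intro u
    have hc := Real.cosh_pos (z u)
    have : 1 - Real.exp (-σ u) = (|Real.sinh (z u)| / Real.cosh (z u)) ^ 2 := by
      rw [hσ, Real.exp_neg, Real.exp_log (by positivity), div_pow, sq_abs, Real.sinh_sq]
      field_simp
    rw [this, Real.sqrt_sq (by positivity)]
  have h2 : t * Real.exp (-∑ u ∈ s, σ u) = (√t * ∏ u ∈ s, (Real.cosh (z u))⁻¹) ^ 2 := by
    rw [mul_pow, Real.sq_sqrt ht0.le, Real.exp_neg, Real.exp_sum, ← prod_inv_distrib,
      ← prod_pow]
    congr 1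
    refine prod_congr rfl fun u _ => ?_
    rw [hσ, Real.exp_log (by positivity), inv_pow]
  rw [sum_congr rfl (fun u _ => h1 u), h2] at hC
  have hB0 : 0 ≤ ∑ u ∈ s, |Real.sinh (z u)| / Real.cosh (z u) :=
    sum_nonneg fun u _ => by positivity
  have hQ0 : 0 ≤ √t * ∏ u ∈ s, (Real.cosh (z u))⁻¹ := by positivity
  have hκ0 : 0 ≤ t * (Λc + 1) / (Λc * (1 + t)) := by positivity
  have key : (√t * (∏ u ∈ s, (Real.cosh (z u))⁻¹) *
      ∑ u ∈ s, |Real.sinh (z u)| / Real.cosh (z u)) ^ 2 ≤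
      (√(t * (Λc + 1) / (Λc * (1 + t))) *
        √(1 + (√t * ∏ u ∈ s, (Real.cosh (z u))⁻¹) ^ 2)) ^ 2 := by
    rw [mul_pow (√(t * (Λc + 1) / (Λc * (1 + t)))), Real.sq_sqrt hκ0,
      Real.sq_sqrt (by positivity)]
    calc (√t * (∏ u ∈ s, (Real.cosh (z u))⁻¹) *
          ∑ u ∈ s, |Real.sinh (z u)| / Real.cosh (z u)) ^ 2
        = (∑ u ∈ s, |Real.sinh (z u)| / Real.cosh (z u)) ^ 2 *
            (√t * ∏ u ∈ s, (Real.cosh (z u))⁻¹) ^ 2 := by ring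
      _ ≤ _ := hC
  exact (pow_le_pow_iff_left₀ (mul_nonneg hQ0 hB0) (by positivity) two_ne_zero).1 key

/-- `|a²/(1+a²) - b²/(1+b²)| ≤ |a - b|` for `a, b ≥ 0` (the occupation probability
`p = ρ/(1+ρ)` is `1`-Lipschitz in `√ρ`). [folklore] -/
theorem abs_sq_div_one_add_sq_sub_le {a b : ℝ} (ha : 0 ≤ a) (hb : 0 ≤ b) :
    |a ^ 2 / (1 + a ^ 2) - b ^ 2 / (1 + b ^ 2)| ≤ |a - b| := by
  rw [div_sub_div _ _ (by positivity) (by positivity), abs_div,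
    abs_of_pos (by positivity : (0 : ℝ) < (1 + a ^ 2) * (1 + b ^ 2)),
    div_le_iff₀ (by positivity),
    show a ^ 2 * (1 + b ^ 2) - (1 + a ^ 2) * b ^ 2 = (a - b) * (a + b) by ring, abs_mul,
    abs_of_nonneg (by positivity : 0 ≤ a + b)]
  refine mul_le_mul_of_nonneg_left ?_ (abs_nonneg _)
  nlinarith [sq_nonneg (a - 1), sq_nonneg (b - 1), sq_nonneg (a * b)]

end Analysis


section Induction

variable {V : Type*} [Fintype V] [DecidableEq V] {G : SimpleGraph V} [DecidableRel G.Adj]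

/-- A priori bounds in the potential coordinate: `0 ≤ arsinh √ρ_v ≤ arsinh √λ` for a free
vertex `v ∉ Λ ⊇ R`. [folklore] -/
theorem arsinh_sqrt_ratio_mem {lam : ℝ} (hlam : 0 < lam) {Λ R : Finset V} {v : V}
    (hvΛ : v ∉ Λ) (hR : R ⊆ Λ) (hind : G.IsIndepSet (R : Set V)) :
    0 ≤ Real.arsinh √(hardCoreZ G lam (insert v Λ) (insert v R) /
        hardCoreZ G lam (insert v Λ) R) ∧
      Real.arsinh √(hardCoreZ G lam (insert v Λ) (insert v R) /
        hardCoreZ G lam (insert v Λ) R) ≤ Real.arsinh √lam :=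
  ⟨Real.arsinh_nonneg_iff.2 (Real.sqrt_nonneg _),
    Real.arsinh_le_arsinh.2 (Real.sqrt_le_sqrt (ratio_le G hlam hvΛ hR hind))⟩

/-- **The contraction induction** (strong spatial mixing in the potential coordinate): in a
graph of maximum degree `≤ d + 1`, for `0 < t < λ_c(d+1)` and a free vertex `v` with at most
`d` free neighbours, if two feasible boundary conditions on the same boundary set `Λ` agree on
the ball of radius `n` around `v`, then the potentials `y_v = arsinh √ρ_v` of the two occupation
ratios differ by at most `κ^n · arsinh √t`, `κ² = t(λ_c+1)/(λ_c(1+t)) < 1`.  Induction on `n`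
through Weitz's recursion `ratio_eq_mul_prod` (the children are free vertices of the same graph
with the enlarged boundary sets `L_u ∋ v`, hence with at most `d` free neighbours, and the two
boundary conditions agree on their balls of radius `n - 1`) and the gradient bound
`potential_gradient_bound` via `arsinh_potential_lipschitz`.  This is Weitz's Theorem 2.3
(the tree `T̂_b` is the worst case) combined with the tree contraction below `λ_c(b)` in the
Li–Lu–Yin / Restrepo–Shin–Tetali–Vigoda–Yang potential form (their Theorem 5 and Lemma 4).
[cite: Weitz2006, Thm. 2.3 with Thm. 2.4 and Prop. 2.5] -/
theorem arsinh_sqrt_ratio_sub_le {d : ℕ} (hG : G.maxDegree ≤ d + 1) {Λc t : ℝ}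
    (hΛ : Λc = hardCoreThreshold (d + 1)) (hΛpos : 0 < Λc) (ht0 : 0 < t) (htΛ : t < Λc)
    (n : ℕ) :
    ∀ (Λ R R' : Finset V) (v : V), R ⊆ Λ → R' ⊆ Λ →
      G.IsIndepSet (R : Set V) → G.IsIndepSet (R' : Set V) → v ∉ Λ →
      (G.neighborFinset v \ insert v Λ).card ≤ d →
      (∀ w, G.edist v w ≤ n → (w ∈ R ↔ w ∈ R')) →
      |Real.arsinh √(hardCoreZ G t (insert v Λ) (insert v R) / hardCoreZ G t (insert v Λ) R) -
          Real.arsinh √(hardCoreZ G t (insert v Λ) (insert v R') /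
            hardCoreZ G t (insert v Λ) R')| ≤
        √(t * (Λc + 1) / (Λc * (1 + t))) ^ n * Real.arsinh √t := by
  induction n with
  | zero =>
    intro Λ R R' v hR hR' hiR hiR' hv _ _
    rw [pow_zero, one_mul]
    obtain ⟨h1, h2⟩ := arsinh_sqrt_ratio_mem (G := G) ht0 hv hR hiR
    obtain ⟨h1', h2'⟩ := arsinh_sqrt_ratio_mem (G := G) ht0 hv hR' hiR'
    exact abs_sub_le_iff.2 ⟨by linarith, by linarith⟩
  | succ n ih =>
    intro Λ R R' v hR hR' hiR hiR' hv hcard hagree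
    have hε0 : 0 ≤ √(t * (Λc + 1) / (Λc * (1 + t))) ^ (n + 1) * Real.arsinh √t :=
      mul_nonneg (pow_nonneg (Real.sqrt_nonneg _) _) (Real.arsinh_nonneg_iff.2 (Real.sqrt_nonneg _))
    have hε0' : 0 ≤ √(t * (Λc + 1) / (Λc * (1 + t))) ^ n * Real.arsinh √t :=
      mul_nonneg (pow_nonneg (Real.sqrt_nonneg _) _) (Real.arsinh_nonneg_iff.2 (Real.sqrt_nonneg _))
    have hagree1 : ∀ u, G.Adj v u → (u ∈ R ↔ u ∈ R') := fun u hu =>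
      hagree u (by rw [SimpleGraph.edist_eq_one_iff_adj.2 hu]; exact_mod_cast Nat.le_add_left 1 n)
    by_cases hex : ∃ u ∈ R, G.Adj v u
    · have hex' : ∃ u ∈ R', G.Adj v u := by
        obtain ⟨u, hu, hvu⟩ := hex
        exact ⟨u, (hagree1 u hvu).1 hu, hvu⟩
      rw [hardCoreZ_insert_insert_eq_zero G hv hR hex,
        hardCoreZ_insert_insert_eq_zero G hv hR' hex', zero_div, zero_div, sub_self, abs_zero]
      exact hε0
    · have hex' : ¬ ∃ u ∈ R', G.Adj v u := fun ⟨u, hu, hvu⟩ => hex ⟨u, (hagree1 u hvu).2 hu, hvu⟩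
      have hRB : R ⊆ insert v Λ := hR.trans (subset_insert v Λ)
      have hRB' : R' ⊆ insert v Λ := hR'.trans (subset_insert v Λ)
      obtain ⟨L, hL, hZ⟩ := hardCoreZ_telescope G ht0 (insert v Λ)
        (G.neighborFinset v \ insert v Λ) sdiff_disjoint
      rw [ratio_eq_mul_prod G ht0 hv hR hiR hex L (fun u hu => ⟨(hL u hu).1, (hL u hu).2.1⟩)
          (hZ R hRB hiR),
        ratio_eq_mul_prod G ht0 hv hR' hiR' hex' L (fun u hu => ⟨(hL u hu).1, (hL u hu).2.1⟩)
          (hZ R' hRB' hiR'),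
        sqrt_mul_prod_inv_one_add ht0.le _ _ (fun u _ => ratio_nonneg G ht0.le _ _ _),
        sqrt_mul_prod_inv_one_add ht0.le _ _ (fun u _ => ratio_nonneg G ht0.le _ _ _)]
      -- the children satisfy the induction hypothesis
      have hchild : ∀ u ∈ G.neighborFinset v \ insert v Λ,
          |Real.arsinh √(hardCoreZ G t (insert u (L u)) (insert u R) /
              hardCoreZ G t (insert u (L u)) R) -
            Real.arsinh √(hardCoreZ G t (insert u (L u)) (insert u R') /
              hardCoreZ G t (insert u (L u)) R')| ≤
            √(t * (Λc + 1) / (Λc * (1 + t))) ^ n * Real.arsinh √t := by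
        intro u hu
        obtain ⟨hBL, huL, -⟩ := hL u hu
        have hvu : G.Adj v u := (G.mem_neighborFinset v u).1 (mem_sdiff.1 hu).1
        have hvL : v ∈ insert u (L u) := mem_insert_of_mem (hBL (mem_insert_self v Λ))
        refine ih (L u) R R' u (hRB.trans hBL) (hRB'.trans hBL) hiR hiR' huL
          (card_neighborFinset_sdiff_le G hG hvL hvu.symm) fun w hw => hagree w ?_
        calc G.edist v w ≤ G.edist v u + G.edist u w := G.edist_triangle
          _ ≤ 1 + (n : ℕ∞) := by
              rw [SimpleGraph.edist_eq_one_iff_adj.2 hvu]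
              gcongr
          _ = ((n + 1 : ℕ) : ℕ∞) := by push_cast; ring
      have hlip := (arsinh_potential_lipschitz (G.neighborFinset v \ insert v Λ)
        (t := t) (K := √(t * (Λc + 1) / (Λc * (1 + t))))
        (ε := √(t * (Λc + 1) / (Λc * (1 + t))) ^ n * Real.arsinh √t)
        hε0' _ _ hchild
        (fun z => potential_gradient_bound hΛ hΛpos ht0 htΛ hcard z)).1
      calc _ ≤ √(t * (Λc + 1) / (Λc * (1 + t))) *
            (√(t * (Λc + 1) / (Λc * (1 + t))) ^ n * Real.arsinh √t) := hlip
        _ = _ := by ring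

/-- **The root step**: at a free vertex `v` (up to `d + 1` free neighbours) whose boundary
conditions agree on the ball of radius `n + 1` and occupy no neighbour of `v`, the two
occupation probabilities differ by at most `√t (d+1) κ^n arsinh √t`
(`|p - p'| ≤ |√ρ - √ρ'|`, the crude Lipschitz bound of `arsinh_potential_lipschitz` for
`√ρ = √t ∏ (cosh y_u)⁻¹`, and `arsinh_sqrt_ratio_sub_le` for the children).
[cite: Weitz2006, Cor. 2.6 (proof)] -/
theorem hardCoreOccProb_sub_le_of_agree {d : ℕ} (hG : G.maxDegree ≤ d + 1) {Λc t : ℝ}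
    (hΛ : Λc = hardCoreThreshold (d + 1)) (hΛpos : 0 < Λc) (ht0 : 0 < t) (htΛ : t < Λc)
    (n : ℕ) {Λ R R' : Finset V} {v : V} (hR : R ⊆ Λ) (hR' : R' ⊆ Λ)
    (hiR : G.IsIndepSet (R : Set V)) (hiR' : G.IsIndepSet (R' : Set V)) (hv : v ∉ Λ)
    (hagree : ∀ w, G.edist v w ≤ (n + 1 : ℕ) → (w ∈ R ↔ w ∈ R')) :
    |hardCoreOccProb G t Λ R v - hardCoreOccProb G t Λ R' v| ≤
      √t * (d + 1) * (√(t * (Λc + 1) / (Λc * (1 + t))) ^ n * Real.arsinh √t) := by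
  have hε0 : 0 ≤ √(t * (Λc + 1) / (Λc * (1 + t))) ^ n * Real.arsinh √t :=
    mul_nonneg (pow_nonneg (Real.sqrt_nonneg _) _) (Real.arsinh_nonneg_iff.2 (Real.sqrt_nonneg _))
  have hagree1 : ∀ u, G.Adj v u → (u ∈ R ↔ u ∈ R') := fun u hu =>
    hagree u (by rw [SimpleGraph.edist_eq_one_iff_adj.2 hu]; exact_mod_cast Nat.le_add_left 1 n)
  rw [hardCoreOccProb_eq_ratio G ht0 hv hR hiR, hardCoreOccProb_eq_ratio G ht0 hv hR' hiR']
  by_cases hex : ∃ u ∈ R, G.Adj v u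
  · have hex' : ∃ u ∈ R', G.Adj v u := by
      obtain ⟨u, hu, hvu⟩ := hex
      exact ⟨u, (hagree1 u hvu).1 hu, hvu⟩
    rw [hardCoreZ_insert_insert_eq_zero G hv hR hex, hardCoreZ_insert_insert_eq_zero G hv hR' hex']
    simp only [zero_div, sub_self, abs_zero]
    exact mul_nonneg (by positivity) hε0
  · have hex' : ¬ ∃ u ∈ R', G.Adj v u := fun ⟨u, hu, hvu⟩ => hex ⟨u, (hagree1 u hvu).2 hu, hvu⟩
    have hRB : R ⊆ insert v Λ := hR.trans (subset_insert v Λ)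
    have hRB' : R' ⊆ insert v Λ := hR'.trans (subset_insert v Λ)
    obtain ⟨L, hL, hZ⟩ := hardCoreZ_telescope G ht0 (insert v Λ)
      (G.neighborFinset v \ insert v Λ) sdiff_disjoint
    -- `p = (√ρ)² / (1 + (√ρ)²)` and `|p - p'| ≤ |√ρ - √ρ'|`
    have hsq : ∀ R₀ : Finset V,
        hardCoreZ G t (insert v Λ) (insert v R₀) / hardCoreZ G t (insert v Λ) R₀ =
          √(hardCoreZ G t (insert v Λ) (insert v R₀) / hardCoreZ G t (insert v Λ) R₀) ^ 2 :=
      fun R₀ => (Real.sq_sqrt (ratio_nonneg G ht0.le _ _ _)).symm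
    rw [hsq R, hsq R']
    refine (abs_sq_div_one_add_sq_sub_le (Real.sqrt_nonneg _) (Real.sqrt_nonneg _)).trans ?_
    rw [ratio_eq_mul_prod G ht0 hv hR hiR hex L (fun u hu => ⟨(hL u hu).1, (hL u hu).2.1⟩)
        (hZ R hRB hiR),
      ratio_eq_mul_prod G ht0 hv hR' hiR' hex' L (fun u hu => ⟨(hL u hu).1, (hL u hu).2.1⟩)
        (hZ R' hRB' hiR'),
      sqrt_mul_prod_inv_one_add ht0.le _ _ (fun u _ => ratio_nonneg G ht0.le _ _ _),
      sqrt_mul_prod_inv_one_add ht0.le _ _ (fun u _ => ratio_nonneg G ht0.le _ _ _)]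
    have hchild : ∀ u ∈ G.neighborFinset v \ insert v Λ,
        |Real.arsinh √(hardCoreZ G t (insert u (L u)) (insert u R) /
            hardCoreZ G t (insert u (L u)) R) -
          Real.arsinh √(hardCoreZ G t (insert u (L u)) (insert u R') /
            hardCoreZ G t (insert u (L u)) R')| ≤
          √(t * (Λc + 1) / (Λc * (1 + t))) ^ n * Real.arsinh √t := by
      intro u hu
      obtain ⟨hBL, huL, -⟩ := hL u hu
      have hvu : G.Adj v u := (G.mem_neighborFinset v u).1 (mem_sdiff.1 hu).1
      have hvL : v ∈ insert u (L u) := mem_insert_of_mem (hBL (mem_insert_self v Λ))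
      refine arsinh_sqrt_ratio_sub_le hG hΛ hΛpos ht0 htΛ n (L u) R R' u (hRB.trans hBL)
        (hRB'.trans hBL) hiR hiR' huL (card_neighborFinset_sdiff_le G hG hvL hvu.symm)
        fun w hw => hagree w ?_
      calc G.edist v w ≤ G.edist v u + G.edist u w := G.edist_triangle
        _ ≤ 1 + (n : ℕ∞) := by
            rw [SimpleGraph.edist_eq_one_iff_adj.2 hvu]
            gcongr
        _ = ((n + 1 : ℕ) : ℕ∞) := by push_cast; ring
    have hcard : ((G.neighborFinset v \ insert v Λ).card : ℝ) ≤ d + 1 := by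
      have : (G.neighborFinset v \ insert v Λ).card ≤ d + 1 :=
        calc (G.neighborFinset v \ insert v Λ).card ≤ (G.neighborFinset v).card :=
              card_le_card sdiff_subset
          _ ≤ d + 1 := by
              rw [G.card_neighborFinset_eq_degree]; exact (G.degree_le_maxDegree v).trans hG
      exact_mod_cast this
    have hlip := (arsinh_potential_lipschitz (G.neighborFinset v \ insert v Λ)
      (t := t) (K := (G.neighborFinset v \ insert v Λ).card)
      (ε := √(t * (Λc + 1) / (Λc * (1 + t))) ^ n * Real.arsinh √t)
      hε0 _ _ hchild
      (fun z => potential_gradient_bound_card t _ z)).2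
    exact hlip.trans (mul_le_mul_of_nonneg_right
      (mul_le_mul_of_nonneg_left hcard (Real.sqrt_nonneg _)) hε0)

end Induction

/-- **Weitz's theorem, proved** [Weitz2006, Cor. 2.6]: for `Δ ≥ 3` and `0 < λ < λ_c(Δ)` the
hard-core model on every finite graph of maximum degree `≤ Δ` has strong spatial mixing with an
exponential rate depending on `Δ` and `λ` only.  With `d = Δ - 1`, `κ = √(λ(λ_c+1)/(λ_c(1+λ)))`
(`< 1`, `PetersRegts.gap_pos`) the constants are `α = -log κ` and
`C = (1 + √λ Δ arsinh √λ) / κ²`: for `ℓ ≤ 1` the bound is the trivial `|p - p'| ≤ 1`; for a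
prescribed vertex `v ∈ Λ` the two probabilities agree (`∈ {0, 1}`); and for a free vertex the
root step `hardCoreOccProb_sub_le_of_agree` applies with agreement radius `ℓ - 1`.  The proof is
Weitz's (§§2–3: the recursion for the occupation ratios with the boundary sets grown along
self-avoiding walks, the worst case being `d` free children at every non-root vertex), with the
tree contraction below `λ_c` carried out in the `arsinh √·` potential of Li–Lu–Yin and
Restrepo–Shin–Tetali–Vigoda–Yang (2013, §4.1, Thm. 5) — whose key inequality is
`PetersRegts.contraction_bound` — in place of Weitz's appeal to Kelly's weak spatial mixing on
the regular tree (Thm. 2.4, Prop. 2.5). [cite: Weitz2006, Cor. 2.6] -/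
theorem _root_.Literature.Probability.LatticeModels.Weitz2006_hardCoreSSM_holds :
    Weitz2006_hardCoreSSM := by
  intro Δ hΔ lam h0 hc
  obtain ⟨d, rfl⟩ : ∃ d, Δ = d + 1 := ⟨Δ - 1, by omega⟩
  obtain ⟨Λc, hΛc⟩ : ∃ Λc : ℝ, Λc = hardCoreThreshold (d + 1) := ⟨_, rfl⟩
  rw [← hΛc] at hc
  have hΛpos : 0 < Λc := hΛc ▸ hardCoreThreshold_pos (by omega)
  obtain ⟨κ, hκ⟩ : ∃ κ : ℝ, κ = √(lam * (Λc + 1) / (Λc * (1 + lam))) := ⟨_, rfl⟩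
  have hκpos : 0 < κ := hκ ▸ Real.sqrt_pos.2 (by positivity)
  have hκlt : κ < 1 := by
    rw [hκ, Real.sqrt_lt' one_pos, one_pow]
    have := PetersRegts.gap_pos hΛpos h0.le hc
    linarith
  obtain ⟨M, hM⟩ : ∃ M : ℝ, M = Real.arsinh √lam := ⟨_, rfl⟩
  have hM0 : 0 ≤ M := hM ▸ Real.arsinh_nonneg_iff.2 (Real.sqrt_nonneg _)
  have hd1 : (0 : ℝ) < d + 1 := by positivity
  refine ⟨(1 + √lam * (d + 1) * M) / κ ^ 2, -Real.log κ, by positivity,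
    neg_pos.2 (Real.log_neg hκpos hκlt), ?_⟩
  intro V _ _ G _ hG v Λ R R' hR hR' hiR hiR' ℓ hdist
  -- the rate `e^{-αℓ} = κ^ℓ`
  rw [show -(-Real.log κ * (ℓ : ℝ)) = ℓ * Real.log κ by ring, Real.exp_nat_mul,
    Real.exp_log hκpos]
  -- the trivial bound `|p - p'| ≤ 1`
  have htriv : |hardCoreOccProb G lam Λ R v - hardCoreOccProb G lam Λ R' v| ≤ 1 := by
    have h1 := hardCoreOccProb_nonneg G h0.le Λ R v
    have h2 := hardCoreOccProb_le_one G h0.le Λ R v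
    have h3 := hardCoreOccProb_nonneg G h0.le Λ R' v
    have h4 := hardCoreOccProb_le_one G h0.le Λ R' v
    exact abs_sub_le_iff.2 ⟨by linarith, by linarith⟩
  -- agreement on balls from the distance hypothesis
  have hagree : ∀ m : ℕ, m + 1 ≤ ℓ → ∀ w, G.edist v w ≤ m → (w ∈ R ↔ w ∈ R') := by
    intro m hm w hw
    by_contra hne
    have h1 : (w ∈ R ↔ w ∉ R') := by tauto
    have h2 : (ℓ : ℕ∞) ≤ m := (hdist w h1).trans hw
    have h3 : ℓ ≤ m := by exact_mod_cast h2
    omega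
  have hC1 : 1 ≤ (1 + √lam * (d + 1) * M) / κ ^ 2 * κ ^ ℓ ↔
      κ ^ 2 ≤ (1 + √lam * (d + 1) * M) * κ ^ ℓ := by
    rw [div_mul_eq_mul_div, le_div_iff₀ (by positivity), one_mul]
  rcases Nat.lt_or_ge ℓ 2 with hℓ | hℓ
  · -- `ℓ ≤ 1`: the trivial bound
    refine htriv.trans (hC1.2 ?_)
    have hκℓ : κ ^ 2 ≤ κ ^ ℓ := pow_le_pow_of_le_one hκpos.le hκlt.le (by omega)
    have : κ ^ ℓ ≤ (1 + √lam * (d + 1) * M) * κ ^ ℓ :=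
      le_mul_of_one_le_left (by positivity) (le_add_of_nonneg_right (by positivity))
    linarith
  · obtain ⟨m, rfl⟩ : ∃ m, ℓ = m + 2 := ⟨ℓ - 2, by omega⟩
    have hag : ∀ w, G.edist v w ≤ (m + 1 : ℕ) → (w ∈ R ↔ w ∈ R') := hagree (m + 1) le_rfl
    by_cases hv : v ∈ Λ
    · -- a prescribed vertex: the two probabilities coincide
      have hvv : v ∈ R ↔ v ∈ R' := hag v (by rw [SimpleGraph.edist_self]; exact bot_le)
      have hsame : hardCoreOccProb G lam Λ R v = hardCoreOccProb G lam Λ R' v := by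
        by_cases hvR : v ∈ R
        · rw [hardCoreOccProb_eq_one_of_mem G hvR (hardCoreZ_pos G h0 hR hiR).ne',
            hardCoreOccProb_eq_one_of_mem G (hvv.1 hvR) (hardCoreZ_pos G h0 hR' hiR').ne']
        · rw [hardCoreOccProb_eq_zero_of_mem_of_not_mem G hv hvR,
            hardCoreOccProb_eq_zero_of_mem_of_not_mem G hv (fun h => hvR (hvv.2 h))]
      rw [hsame, sub_self, abs_zero]
      positivity
    · -- a free vertex: the root step
      refine (hardCoreOccProb_sub_le_of_agree hG hΛc hΛpos h0 hc m hR hR' hiR hiR' hv hag).trans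
        ?_
      rw [← hκ, ← hM, pow_add, div_mul_eq_mul_div, le_div_iff₀ (by positivity)]
      have : 0 ≤ κ ^ m := by positivity
      nlinarith [mul_nonneg this (sq_nonneg κ), Real.sqrt_nonneg lam]

end Weitz

end Literature.Probability.LatticeModels
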